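import Literature.Geometry.Lorentzian.NearKerrLeafMinkowskiBoostedDodge
import Literature.Geometry.Lorentzian.LeafAdaptedModelChartsMinkowski
import Summits.FinalStateConjecture.FinalStateConjecture.Theorems.SeamedChartsExhaust.Negative.ReversedFlatChart
import HarnessLib

/-!
# Stub `stub_minkowskiDodgeLeaves` of line `inflow-ledger-open-system` of crux `Capture`
# (stmt-FinalStateConjecture-10115): the crux HYPOTHESIS localises nothing in Minkowski space

The crux `Capture` (routes `BartnikGapSettling` / `QuietWindowCapture`, summit
`FinalStateConjecture`) assumes, for every `(k, ε, K)`, an `(ε, k)`-near-Kerr leaf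
(`CauchyDevelopment.IsNearKerrLeaf`, `Literature/Geometry/Lorentzian/NearKerrLeaf.lean`) beyond
`J⁻(K)`.  This file proves the registered sanity stub `stub_minkowskiDodgeLeaves` of
`Summits/FinalStateConjecture/FinalStateConjecture/Cruxes/Capture/Lines/inflow_ledger_open_system.lean`
(verbatim): in the Minkowski development `Minkowski.vacuumCauchyDevelopment` there is, for every
`k`, every `ε > 0`, every compact `K ⊆ ℝ⁴`, every rest position `x̲_obs ∈ ℝ³` and every `D`, a
`0`-hole `(ε, k)`-near-Kerr leaf `S` disjoint from `J⁻(K)` ALL of whose points are at spatial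
distance `> D` from `x̲_obs` — so the hypothesis never forces a leaf to come near a prescribed
bounded region of space.

Proof.  Bound the time coordinate on the compact `K` by `T` (`IsCompact.bddAbove_image`); then
`x⁰ ≤ T` on `J⁻(K)` (`J⁻(K) = ⋃_{q ∈ K} J⁻(q)` and `J⁻(q)` is the solid past cone,
`ReversedModel.time_le_of_mem_causalPast_singleton`).  Put `p = (T + 1, 0)` and take the boosted
stretched hyperboloid `S ⊆ J⁺(p)` of
`Minkowski.exists_isNearKerrLeaf_subset_causalFuture_forall_dist_lt` (an `(ε, k)`-leaf with `0`
holes, at spatial distance `> D` from `x̲_obs`).  On `J⁺(p)` the time coordinate is `≥ T + 1`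
(`Minkowski.causalFuture_singleton`: `J⁺(p)` is the solid future cone), so `S ∩ J⁻(K) = ∅`.

No named facts are used and no definitions are introduced.  References: B. O'Neill,
*Semi-Riemannian geometry*, Academic Press 1983, Ch. 9 (boosts) and Ch. 14, p. 402 (causality of
`ℝ⁴₁`); M. Dafermos, G. Holzegel, I. Rodnianski, M. Taylor, arXiv:2104.08222, §1 (the leaf
vocabulary).
-/

-- the doubled `FinalStateConjecture.FinalStateConjecture` path component trips dupNamespace
set_option linter.dupNamespace false

noncomputable section

namespace Summit.FinalStateConjecture.FinalStateConjecture.Theorems.BartnikGapSettling.Capture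

open Set
open scoped ENNReal
open Literature.Geometry.Lorentzian
-- `ReversedModel.*`: `J⁻` of sets and points in Minkowski spacetime
open Summit.FinalStateConjecture.FinalStateConjecture.Theorems.SeamedChartsExhaust.Negative

/-- A compact subset of `ℝ⁴` has time coordinate bounded above. [folklore] -/
private theorem exists_forall_time_le' {K : Set E4} (hK : IsCompact K) :
    ∃ T : ℝ, ∀ x ∈ K, x 0 ≤ T := by
  have hc : Continuous fun x : E4 => x 0 := by fun_prop
  obtain ⟨T, hT⟩ := hK.bddAbove_image hc.continuousOn
  exact ⟨T, fun x hx => hT (mem_image_of_mem (fun x : E4 => x 0) hx)⟩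

/-- If the time coordinate is `≤ T` on `K ⊆ ℝ⁴₁`, it is `≤ T` on `J⁻(K)` (`J⁻(q)` is the solid past
cone, `Minkowski.causalPast_singleton`). O'Neill 1983, Ch. 14, p. 402. [folklore] -/
private theorem time_le_of_mem_causalPast' {T : ℝ} {K : Set E4} (hTK : ∀ x ∈ K, x 0 ≤ T) {z : E4}
    (hz : z ∈ Minkowski.vacuumCauchyDevelopment.metric.causalPast
      Minkowski.vacuumCauchyDevelopment.timeOrientation K) : z 0 ≤ T := by
  obtain ⟨q, hqK, hzq⟩ := ReversedModel.exists_mem_causalPast_singleton_of_mem_causalPast hz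
  exact (ReversedModel.time_le_of_mem_causalPast_singleton hzq).trans (hTK q hqK)

/-- On the solid future cone `J⁺(p)` of Minkowski spacetime the time coordinate is `≥ p⁰`
(`Minkowski.causalFuture_singleton`). O'Neill 1983, Ch. 14, p. 402. [folklore] -/
private theorem time_le_of_mem_causalFuture_singleton' {p z : E4}
    (hz : z ∈ Minkowski.vacuumCauchyDevelopment.metric.causalFuture
      Minkowski.vacuumCauchyDevelopment.timeOrientation ({p} : Set E4)) : p 0 ≤ z 0 := by
  have h : z ∈ {q : E4 | ‖E4.spatial q - E4.spatial p‖ ≤ q 0 - p 0} :=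
    (Set.ext_iff.mp (Minkowski.causalFuture_singleton p) z).mp hz
  rw [mem_setOf_eq] at h
  linarith [norm_nonneg (E4.spatial z - E4.spatial p)]

/-- **Dodge instance of the crux hypothesis** (stub `stub_minkowskiDodgeLeaves` of line
`inflow-ledger-open-system`, crux `Capture`, stmt-FinalStateConjecture-10115): in the Minkowski
development `Minkowski.vacuumCauchyDevelopment`, for every `k`, every `ε > 0`, every compact `K`,
every rest position `x̲_obs` and every `D` there is a `0`-hole `(ε, k)`-near-Kerr leaf disjoint
from `J⁻(K)` all of whose points are at spatial distance `> D` from `x̲_obs`: the boosted stretched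
hyperboloid of `Minkowski.exists_isNearKerrLeaf_subset_causalFuture_forall_dist_lt` placed in
`J⁺(p)`, `p = (T + 1, 0)` with `T ≥ sup_K x⁰`, since `x⁰ ≤ T` on `J⁻(K)` and `x⁰ ≥ T + 1` on
`J⁺(p)` (solid light cones of `ℝ⁴₁`). [cite: ONeillSemiRiemannian1983, Ch. 14, p. 402] -/
theorem stub_minkowskiDodgeLeaves :
    ∀ (k : ℕ) (ε : ℝ≥0∞), 0 < ε → ∀ K : Set Minkowski.vacuumCauchyDevelopment.carrier, IsCompact K →
      ∀ (x_obs : E3) (D : ℝ), ∃ S : Set Minkowski.vacuumCauchyDevelopment.carrier,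
        Disjoint S (Minkowski.vacuumCauchyDevelopment.metric.causalPast
            Minkowski.vacuumCauchyDevelopment.timeOrientation K) ∧
          Minkowski.vacuumCauchyDevelopment.toCauchyDevelopment.IsNearKerrLeaf k ε 0 ![] ![] S ∧
            ∀ z ∈ S, D < ‖E4.spatial z - x_obs‖ := by
  intro k ε hε K hK x_obs D
  obtain ⟨T, hTK⟩ := exists_forall_time_le' hK
  obtain ⟨S, hleaf, hSJ, hdist, -⟩ :=
    Minkowski.exists_isNearKerrLeaf_subset_causalFuture_forall_dist_lt k hε
      (E4.ofTimeSpace (T + 1) 0) x_obs D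
  refine ⟨S, Set.disjoint_left.2 fun z hzS hzK => ?_, hleaf, hdist⟩
  have h1 : E4.ofTimeSpace (T + 1) 0 0 ≤ z 0 := time_le_of_mem_causalFuture_singleton' (hSJ hzS)
  rw [E4.ofTimeSpace_apply_zero] at h1
  have h2 : z 0 ≤ T := time_le_of_mem_causalPast' hTK hzK
  linarith

end Summit.FinalStateConjecture.FinalStateConjecture.Theorems.BartnikGapSettling.Capture

end
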